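import Summits.MatrixMultiplication.MatrixMultiplication.Theorems.ThinPackings.Negative.ThinPackingsGenuinelyThin
import Summits.MatrixMultiplication.MatrixMultiplication.Theorems.ThinBlockAlphaUSPToBounded
import Literature.Computability.AlgebraicComplexity.LocalStrongUSP

set_option linter.dupNamespace false  -- `Summit.<S>.<S>.…` is the mandated namespace (lakefile does the same)

/-!
# Rescaling designs in the crux matrix of `ThinBlockAlpha.ThinPackings` (crux stmt-MatrixMultiplication-10595), IV

Standing disprover (cdisprove), cycle 3, part 1 of 3 (TrueWedge and NoLinearBarrier import this).
The crux asks for every slice `(a, η)`, `0 ≤ a < 1`, `η > 0`, for an abelian STPP family of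
blocks `⟨N, M, N⟩`, `N ≥ 2`, `N^a ≤ M`, `|H| ≤ L·N^{2+η}`.

* `thinSlice_of_design` — RESCALING: a witness of `(a₀, η₀)` yields witnesses of every `(a, η)`
  with `0 < a ≤ a₀`, `η/a > η₀/a₀` (power up with `AddSimultaneousTPP.pi`, multiply with one
  exact split block `⟨m, 1, m⟩`, `AddSimultaneousTPP.prod`; unlike the cycle-2 version in
  `ThinPackingsGenuinelyThin` the host count keeps the factor `m²` exact).  So the true region is
  star-shaped from the origin, and (products of two designs, same proof) log-convex: the frontier
  `η*(a) = inf {η : slice (a, η) holds}` is CONVEX with `η*(0) = 0`, `η*(a)/a` monotone, and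
  `ThinPackings ↔ η* ≡ 0 ↔ η*(1) = 0` (`= X_C`, cycle 2).
* `thinSlice_of_usp` — every local strong USP with rows of composition `(p, q, p)` is, through
  the tree's CKSU Theorem 33 (`CohnKleinbergSzegedyUmans2005_thm33_holds`) in `Cyc_ℓ^{2p+q}`, a
  witness of `(q/p, η₀)` whenever `ℓ^{2p+q} ≤ |U|·((ℓ−1)^p)^{2+η₀}`, hence of the whole wedge
  below it.
-/

namespace Summit.MatrixMultiplication.MatrixMultiplication.Theorems.ThinPackings.Negative

open Literature.Computability.AlgebraicComplexity Finset
open Literature.Combinatorics.Additive (AddSimultaneousTPP)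

/-- **Rescaling a design** (power up, then multiply with one exact split block `⟨m, 1, m⟩`).
An STPP family of `L₀` blocks `⟨N₀, M₀, N₀⟩` with `N₀ ≥ 2`, `N₀^{a₀} ≤ M₀` and
`|H₀| ≤ L₀·N₀^{2+η₀}` — a witness of the slice `(a₀, η₀)` — yields witnesses of EVERY slice
`(a, η)` with `0 < a ≤ a₀` and `η/a > η₀/a₀`: the `k`-th power (`AddSimultaneousTPP.pi`, blocks
`⟨ν, M₀^k, ν⟩`, `ν = N₀^k`, same `(a₀, η₀)`) times the split block `⟨m, 1, m⟩` in `(ℤ/m)²`,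
`m = ⌊ν^{(a₀−a)/a}⌋`, has blocks `⟨νm, M₀^k, νm⟩` with `(νm)^a ≤ ν^{a₀} ≤ M₀^k` and host
`|H₀|^k m² ≤ L₀^k (νm)² ν^{η₀} ≤ L₀^k (νm)^{2+η}` as soon as `ν^{η a₀/a − η₀} ≥ 2^η`.
In the `(a, η)` plane: the segment from the origin to a true point is true (and everything
above it).  [new, elementary] -/
theorem thinSlice_of_design {H₀ : Type} [AddCommGroup H₀] [Fintype H₀] {L₀ N₀ M₀ : ℕ}
    {A B C : Fin L₀ → Finset H₀} (hS : IsSTPP A B C)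
    (hc : ∀ i, (A i).card = N₀ ∧ (B i).card = M₀ ∧ (C i).card = N₀) (hN : 2 ≤ N₀)
    {a₀ η₀ : ℝ} (hM : (N₀ : ℝ) ^ a₀ ≤ M₀)
    (hH : (Fintype.card H₀ : ℝ) ≤ L₀ * (N₀ : ℝ) ^ (2 + η₀))
    {a η : ℝ} (ha : 0 < a) (haa : a ≤ a₀) (hη : 0 < η) (hw : η₀ * a < η * a₀) :
    ∃ (H : Type) (_ : AddCommGroup H) (_ : Fintype H) (L N M : ℕ) (A B C : Fin L → Finset H),
      IsSTPP A B C ∧ (∀ i, (A i).card = N ∧ (B i).card = M ∧ (C i).card = N) ∧ 2 ≤ N ∧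
      (N : ℝ) ^ a ≤ M ∧ (Fintype.card H : ℝ) ≤ L * (N : ℝ) ^ (2 + η) := by
  classical
  have hS' := (isSTPP_iff_addSimultaneousTPP A B C).1 hS
  have hn1 : (1 : ℝ) < N₀ := by exact_mod_cast (by omega : 1 < N₀)
  have hnpos : (0 : ℝ) < N₀ := by linarith
  have hL := one_le_L hH
  -- the gain exponent
  set e : ℝ := η * a₀ / a - η₀ with he_def
  have he : 0 < e := by
    rw [he_def, sub_pos, lt_div_iff₀ ha]; linarith
  -- thresholds for the side `ν = N₀^k`
  set T : ℝ := max 2 ((2 : ℝ) ^ (η / e)) with hT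
  obtain ⟨k, hk⟩ := pow_unbounded_of_one_lt T hn1
  set ν : ℝ := (N₀ : ℝ) ^ k with hν
  have hν2 : (2 : ℝ) < ν := lt_of_le_of_lt (le_max_left _ _) hk
  have hνpos : 0 < ν := by linarith
  have hν1 : 1 ≤ ν := by linarith
  have hνe : (2 : ℝ) ^ η ≤ ν ^ e := by
    have h1 : (2 : ℝ) ^ (η / e) < ν := lt_of_le_of_lt (le_max_right _ _) hk
    have h2 : ((2 : ℝ) ^ (η / e)) ^ e ≤ ν ^ e := Real.rpow_le_rpow (by positivity) h1.le he.le
    rw [← Real.rpow_mul (by norm_num), div_mul_cancel₀ _ he.ne'] at h2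
    exact h2
  -- the multiplier `m`
  have hexp0 : 0 ≤ (a₀ - a) / a := div_nonneg (by linarith) ha.le
  set x : ℝ := ν ^ ((a₀ - a) / a) with hx
  have hx1 : 1 ≤ x := Real.one_le_rpow hν1 hexp0
  set m : ℕ := ⌊x⌋₊ with hm
  have hm_le : (m : ℝ) ≤ x := Nat.floor_le (by positivity)
  have hm_ge : x / 2 ≤ m := by
    -- `⌊x⌋₊ ≥ x/2` for `x ≥ 1`
    rcases lt_or_ge x 2 with h | h
    · have h1 : (1 : ℝ) ≤ (⌊x⌋₊ : ℝ) := by exact_mod_cast Nat.le_floor (by simpa using hx1)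
      rw [hm]; linarith
    · have := Nat.lt_floor_add_one x
      rw [hm]; linarith
  have hm1 : 1 ≤ m := Nat.le_floor (by simpa using hx1)
  have hmpos : (0 : ℝ) < m := by exact_mod_cast (by omega : 0 < m)
  haveI : NeZero m := ⟨by omega⟩
  -- `ν · x = ν^{a₀/a}`
  have hνx : ν * x = ν ^ (a₀ / a) := by
    have h1 : ν ^ (a₀ / a) = ν ^ (1 + (a₀ - a) / a) := by
      congr 1; field_simp; ring
    rw [h1, Real.rpow_add hνpos, Real.rpow_one]
  -- the family: `F^k × (split block)` in `H₀^k × (ℤ/m)²`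
  obtain ⟨A₀, B₀, C₀, hS₀, hc₀⟩ := split_block_two m
  have hS₀' := (isSTPP_iff_addSimultaneousTPP A₀ B₀ C₀).1 hS₀
  have hpow := hS'.pi (κ := Fin k)
  have hprod := hpow.prod hS₀'
  set eqv := Fintype.equivFin ((Fin k → Fin L₀) × Fin 1) with heqv
  have hfin := hprod.comp eqv.symm.injective
  have hνnat : ((N₀ ^ k : ℕ) : ℝ) = ν := by rw [hν]; push_cast; rfl
  have hpiA : ∀ I : Fin k → Fin L₀, (Fintype.piFinset fun l => A (I l)).card = N₀ ^ k := by
    intro I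
    rw [Fintype.card_piFinset, Finset.prod_congr rfl fun l _ => (hc (I l)).1, prod_const, card_univ,
      Fintype.card_fin]
  have hpiB : ∀ I : Fin k → Fin L₀, (Fintype.piFinset fun l => B (I l)).card = M₀ ^ k := by
    intro I
    rw [Fintype.card_piFinset, Finset.prod_congr rfl fun l _ => (hc (I l)).2.1, prod_const,
      card_univ, Fintype.card_fin]
  have hpiC : ∀ I : Fin k → Fin L₀, (Fintype.piFinset fun l => C (I l)).card = N₀ ^ k := by
    intro I
    rw [Fintype.card_piFinset, Finset.prod_congr rfl fun l _ => (hc (I l)).2.2, prod_const,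
      card_univ, Fintype.card_fin]
  refine ⟨(Fin k → H₀) × (ZMod m × ZMod m), inferInstance, inferInstance,
    Fintype.card ((Fin k → Fin L₀) × Fin 1), N₀ ^ k * m, M₀ ^ k,
    fun y => (Fintype.piFinset fun l => A ((eqv.symm y).1 l)) ×ˢ A₀ (eqv.symm y).2,
    fun y => (Fintype.piFinset fun l => B ((eqv.symm y).1 l)) ×ˢ B₀ (eqv.symm y).2,
    fun y => (Fintype.piFinset fun l => C ((eqv.symm y).1 l)) ×ˢ C₀ (eqv.symm y).2,
    ?_, ?_, ?_, ?_, ?_⟩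
  · exact (isSTPP_iff_addSimultaneousTPP _ _ _).2 hfin
  · intro y
    refine ⟨?_, ?_, ?_⟩ <;>
      simp only [card_product, hpiA, hpiB, hpiC, (hc₀ _).1, (hc₀ _).2.1, (hc₀ _).2.2, mul_one]
  · -- `2 ≤ N₀^k * m`
    have h3 : (2 : ℝ) < ((N₀ ^ k : ℕ) : ℝ) := by rw [hνnat]; exact hν2
    have h4 : 2 < N₀ ^ k := by exact_mod_cast h3
    calc 2 ≤ N₀ ^ k := h4.le
      _ = N₀ ^ k * 1 := (mul_one _).symm
      _ ≤ N₀ ^ k * m := Nat.mul_le_mul_left _ hm1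
  · -- `(ν m)^a ≤ ν^{a₀} ≤ M₀^k`
    push_cast
    rw [show ((N₀ : ℝ) ^ k) = ν from rfl]
    have h1 : ν * m ≤ ν ^ (a₀ / a) := by
      calc ν * m ≤ ν * x := by gcongr
        _ = ν ^ (a₀ / a) := hνx
    have hM0 : (0 : ℝ) ≤ (N₀ : ℝ) ^ a₀ := by positivity
    calc (ν * m) ^ a ≤ (ν ^ (a₀ / a)) ^ a := Real.rpow_le_rpow (by positivity) h1 ha.le
      _ = ν ^ a₀ := by rw [← Real.rpow_mul hνpos.le, div_mul_cancel₀ _ ha.ne']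
      _ = ((N₀ : ℝ) ^ a₀) ^ k := by
          rw [hν, ← Real.rpow_natCast, ← Real.rpow_natCast, ← Real.rpow_mul hnpos.le,
            ← Real.rpow_mul hnpos.le, mul_comm]
      _ ≤ (M₀ : ℝ) ^ k := pow_le_pow_left₀ hM0 hM k
  · -- host: `|H₀|^k m² ≤ L₀^k (ν m)^{2+η}`
    have hcardG : (Fintype.card ((Fin k → H₀) × (ZMod m × ZMod m)) : ℝ) =
        (Fintype.card H₀ : ℝ) ^ k * ((m : ℝ) * m) := by
      rw [Fintype.card_prod, Fintype.card_prod, Fintype.card_fun, Fintype.card_fin, ZMod.card]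
      push_cast; ring
    have hcardL : (Fintype.card ((Fin k → Fin L₀) × Fin 1) : ℝ) = (L₀ : ℝ) ^ k := by
      rw [Fintype.card_prod, Fintype.card_fun, Fintype.card_fin, Fintype.card_fin,
        Fintype.card_fin]
      push_cast; ring
    rw [hcardG, hcardL]
    push_cast
    rw [show ((N₀ : ℝ) ^ k) = ν from rfl]
    have hHk : (Fintype.card H₀ : ℝ) ^ k ≤ (L₀ : ℝ) ^ k * ν ^ (2 + η₀) := by
      calc (Fintype.card H₀ : ℝ) ^ k ≤ ((L₀ : ℝ) * (N₀ : ℝ) ^ (2 + η₀)) ^ k :=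
            pow_le_pow_left₀ (Nat.cast_nonneg _) hH k
        _ = (L₀ : ℝ) ^ k * ν ^ (2 + η₀) := by
            rw [mul_pow, hν, ← Real.rpow_natCast ((N₀ : ℝ) ^ (2 + η₀)) k,
              ← Real.rpow_mul hnpos.le, mul_comm (2 + η₀) (k : ℝ), Real.rpow_mul hnpos.le,
              Real.rpow_natCast]
    -- the key comparison `ν^{η₀} ≤ (ν m)^η`
    have hkey : ν ^ η₀ ≤ (ν * m) ^ η := by
      have h1 : ν ^ (a₀ / a) / 2 ≤ ν * m := by
        calc ν ^ (a₀ / a) / 2 = ν * (x / 2) := by rw [← hνx]; ring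
          _ ≤ ν * m := by gcongr
      have h2 : (ν ^ (a₀ / a) / 2) ^ η ≤ (ν * m) ^ η :=
        Real.rpow_le_rpow (by positivity) h1 hη.le
      refine le_trans ?_ h2
      rw [Real.div_rpow (by positivity) (by norm_num), ← Real.rpow_mul hνpos.le,
        le_div_iff₀ (by positivity)]
      -- `ν^{η₀} 2^η ≤ ν^{(a₀/a) η}` since `ν^e ≥ 2^η`, `e = η a₀/a − η₀`
      have h3 : a₀ / a * η = η₀ + e := by rw [he_def]; ring
      rw [h3, Real.rpow_add hνpos]
      gcongr
    calc (Fintype.card H₀ : ℝ) ^ k * ((m : ℝ) * m)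
        ≤ ((L₀ : ℝ) ^ k * ν ^ (2 + η₀)) * ((m : ℝ) * m) := by gcongr
      _ = (L₀ : ℝ) ^ k * ((ν * m) ^ (2 : ℝ) * ν ^ η₀) := by
          rw [Real.rpow_add hνpos, Real.rpow_two, Real.rpow_two]; ring
      _ ≤ (L₀ : ℝ) ^ k * ((ν * m) ^ (2 : ℝ) * (ν * m) ^ η) := by gcongr
      _ = (L₀ : ℝ) ^ k * (ν * m) ^ (2 + η) := by
          rw [Real.rpow_add (by positivity)]



/-- Decidable reformulation of the local strong USP condition (pattern membership as the
boolean "exactly two of `a = 0`, `b = 1`, `c = 2`"). -/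
theorem isLocalStrongUSP_iff_bool {k L : ℕ} (row : Fin L → Fin k → Fin 3) :
    IsLocalStrongUSP row ↔ ∀ a b c : Fin L, (a ≠ b ∨ b ≠ c) → ∃ i : Fin k,
      ((row a i = 0 ∧ row b i = 1 ∧ row c i ≠ 2) ∨ (row a i = 0 ∧ row b i ≠ 1 ∧ row c i = 2) ∨
        (row a i ≠ 0 ∧ row b i = 1 ∧ row c i = 2)) := by
  unfold IsLocalStrongUSP
  simp only [mem_localStrongUSPPatterns_iff]

/-- `c^n ≤ x^q` (`x ≥ 0`, `n ≠ 0`) gives `c ≤ x^{q/n}`. [folklore] -/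
theorem le_rpow_div_of_pow_le {c x : ℝ} (hx : 0 ≤ x) {n q : ℕ} (hn : n ≠ 0)
    (h : c ^ n ≤ x ^ q) : c ≤ x ^ ((q : ℝ) / n) := by
  have hn' : (n : ℝ) ≠ 0 := Nat.cast_ne_zero.2 hn
  have h1 : (x ^ ((q : ℝ) / n)) ^ n = x ^ q := by
    rw [← Real.rpow_natCast (x ^ ((q : ℝ) / n)) n, ← Real.rpow_mul hx, div_mul_cancel₀ _ hn',
      Real.rpow_natCast]
  exact le_of_pow_le_pow_left₀ hn (by positivity) (h.trans_eq h1.symm)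

/-- **Theorem 33 designs feed the rescaling lemma.**  A local strong USP of `Lu` rows of width
`w`, every row of composition `(p, q, p)` (`p` ones, `q` twos, `p` threes), gives in `Cyc_ℓ^w`
an STPP family of `Lu` blocks `⟨(ℓ−1)^p, (ℓ−1)^q, (ℓ−1)^p⟩` (tree: CKSU Thm 33 + counting);
if `ℓ^w ≤ Lu·((ℓ−1)^p)^{2+η₀}` this is a witness of the slice `(q/p, η₀)`, hence
(`thinSlice_of_design`) of every slice `(a, η)` with `0 < a ≤ q/p`, `η·q > η₀·a·p`.
[new, elementary; cite: CohnKleinbergSzegedyUmans2005, Thm. 33] -/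
theorem thinSlice_of_usp {Lu w : ℕ} {row : Fin Lu → Fin w → Fin 3} (hU : IsLocalStrongUSP row)
    {p q : ℕ} (hp0 : p ≠ 0) (hp : ∀ u, (univ.filter fun j => row u j = 0).card = p)
    (hq : ∀ u, (univ.filter fun j => row u j = 1).card = q)
    (hr : ∀ u, (univ.filter fun j => row u j = 2).card = p)
    {ℓ : ℕ} (hℓ : 3 ≤ ℓ) {η₀ : ℝ}
    (hnum : ((ℓ : ℝ)) ^ w ≤ Lu * ((((ℓ - 1) ^ p : ℕ) : ℝ)) ^ (2 + η₀))
    {a η : ℝ} (ha : 0 < a) (haa : a * p ≤ q) (hη : 0 < η) (hw : η₀ * a * p < η * q) :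
    ∃ (H : Type) (_ : AddCommGroup H) (_ : Fintype H) (L N M : ℕ) (A B C : Fin L → Finset H),
      IsSTPP A B C ∧ (∀ i, (A i).card = N ∧ (B i).card = M ∧ (C i).card = N) ∧ 2 ≤ N ∧
      (N : ℝ) ^ a ≤ M ∧ (Fintype.card H : ℝ) ≤ L * (N : ℝ) ^ (2 + η) := by
  haveI : NeZero ℓ := ⟨by omega⟩
  have hS : IsSTPP (uspA ℓ row) (uspB ℓ row) (uspC ℓ row) :=
    CohnKleinbergSzegedyUmans2005_thm33_holds ℓ w Lu row hU
  set X : ℕ := ℓ - 1 with hX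
  have hX2 : 2 ≤ X := by omega
  have hc : ∀ u, (uspA ℓ row u).card = X ^ p ∧ (uspB ℓ row u).card = X ^ q ∧
      (uspC ℓ row u).card = X ^ p := fun u => by
    rw [card_uspA, card_uspB, card_uspC, hp, hq, hr]; exact ⟨rfl, rfl, rfl⟩
  have hN : 2 ≤ X ^ p := hX2.trans (Nat.le_self_pow hp0 _)
  have hppos : (0 : ℝ) < p := by exact_mod_cast Nat.pos_of_ne_zero hp0
  have hpne : (p : ℝ) ≠ 0 := hppos.ne'
  have hx0 : (0 : ℝ) ≤ (X : ℝ) := Nat.cast_nonneg _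
  have hM : (((X ^ p : ℕ) : ℝ)) ^ ((q : ℝ) / p) ≤ ((X ^ q : ℕ) : ℝ) := by
    push_cast
    rw [← Real.rpow_natCast (X : ℝ) p, ← Real.rpow_mul hx0, mul_comm, div_mul_cancel₀ _ hpne,
      Real.rpow_natCast]
  have hH : (Fintype.card (Fin w → ZMod ℓ) : ℝ) ≤ Lu * (((X ^ p : ℕ) : ℝ)) ^ (2 + η₀) := by
    rw [Fintype.card_fun, Fintype.card_fin, ZMod.card]
    push_cast
    have := hnum
    push_cast at this
    exact this
  have haa' : a ≤ (q : ℝ) / p := by rw [le_div_iff₀ hppos]; exact haa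
  have hw' : η₀ * a < η * ((q : ℝ) / p) := by
    rw [← mul_div_assoc, lt_div_iff₀ hppos]; exact hw
  exact thinSlice_of_design hS hc hN hM hH ha haa' hη hw'


end Summit.MatrixMultiplication.MatrixMultiplication.Theorems.ThinPackings.Negative
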